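import Literature.MathematicalPhysics.QuantumLattice.HubbardHighTemperatureAnalytic
import HarnessLib

/-!
# Analyticity in the chemical potential of the high-temperature two-point function

Companion of `HubbardHighTemperatureAnalytic.lean` (holomorphy in the coupling `U`). For real
`0 ≤ β ≤ β₁ = SourceGasC.betaHTc` and REAL `U`, the complex-parameter source gas of that file is run
in the chemical potential: the strip `|β Im μ| < π/6` is admissible (`admissible_of_abs_mul_im_mu_le`:
there `Re z₀ ≥ ½ Σ_E |e^{-βE}|`), the finite-volume two-point functions `μ ↦ twoPtC G β U μ b₀` are
holomorphic on it (quotients of traces of exponentials of matrices affine in `μ`, with non-vanishing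
denominator), they converge uniformly in the volume, and so the thermodynamic limit
`htTwoPointLimitCmu β U σ y` is HOLOMORPHIC in `μ` on the strip and extends the real
high-temperature two-point function (`htTwoPointLimitCmu_ofReal`). At `y = 0` this is the density
per spin `n_σ(β, U, μ) = ⟨n_{0σ}⟩`: **at high temperature the density is a real-analytic function
of the chemical potential for every `U`** (no incompressible plateau), `analyticOnNhd_htDensityC`.

## References

* D. Ueltschi, J. Stat. Phys. 95 (1999) 693, Thm. 2.1 (i) (analyticity of the free energy and of
  the Gibbs state in `β` and `μ` at high temperature). [Ueltschi1999]
* G. Benfatto, A. Giuliani, V. Mastropietro, Ann. Henri Poincaré 7 (2006) 809, Thm. 1.1 (the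
  fact `bgm_two_point_limit`; this file concerns its high-temperature corner only). [BenfattoGiulianiMastropietro2006]
-/

noncomputable section

namespace Literature.MathematicalPhysics.QuantumLattice

open Matrix Finset HubbardWave0 Literature.Probability.LatticeModels Filter SourceGas
open scoped _root_.Topology Matrix.Norms.L2Operator

namespace SourceGasC

/-! ### The strip in the chemical potential -/

/-- **The strip `|β Im μ| ≤ π/6` is admissible** for real `β` and real `U`: the three Boltzmann
factors `1`, `2e^{βμ}`, `e^{-β(U-2μ)}` have arguments `0`, `β Im μ`, `2β Im μ` of modulus `≤ π/3`,
so `Re z₀ ≥ ½ Σ_E |e^{-βE}|`, whence `z₀ ≠ 0` and site ratio `≤ 2`. [folklore] -/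
theorem admissible_of_abs_mul_im_mu_le {β : ℝ} (U : ℝ) {μ : ℂ} (hμ : |β * μ.im| ≤ Real.pi / 6) :
    atomicPartitionFn (β : ℂ) (U : ℂ) μ ≠ 0 ∧ siteRatio (β : ℂ) (U : ℂ) μ ≤ 2 := by
  set a : ℝ := Real.exp (β * μ.re) with ha
  set d : ℝ := Real.exp (-(β * U - 2 * (β * μ.re))) with hd
  have ha0 : 0 < a := Real.exp_pos _
  have hd0 : 0 < d := Real.exp_pos _
  have hcos1 : (1 : ℝ) / 2 ≤ Real.cos (β * μ.im) := by
    rw [← Real.cos_abs, ← Real.cos_pi_div_three]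
    exact Real.cos_le_cos_of_nonneg_of_le_pi (abs_nonneg _) (by linarith [Real.pi_pos]) (by linarith [Real.pi_pos])
  have hcos2 : (1 : ℝ) / 2 ≤ Real.cos (2 * (β * μ.im)) := by
    rw [← Real.cos_abs, ← Real.cos_pi_div_three]
    refine Real.cos_le_cos_of_nonneg_of_le_pi (abs_nonneg _) (by linarith [Real.pi_pos]) ?_
    rw [abs_mul, abs_two]
    linarith
  -- the two exponentials
  have hv_re : ((β : ℂ) * μ).re = β * μ.re := by simp [Complex.mul_re]
  have hv_im : ((β : ℂ) * μ).im = β * μ.im := by simp [Complex.mul_im]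
  have h1 : (Complex.exp ((β : ℂ) * μ)).re = a * Real.cos (β * μ.im) := by
    rw [Complex.exp_re, hv_re, hv_im]
  have hw_re : (-((β : ℂ) * ((U : ℂ) - 2 * μ))).re = -(β * U - 2 * (β * μ.re)) := by
    simp only [Complex.neg_re, Complex.mul_re, Complex.ofReal_re, Complex.ofReal_im, Complex.sub_re, Complex.sub_im,
      Complex.re_ofNat, Complex.im_ofNat, zero_mul, sub_zero, zero_sub]
    ring
  have hw_im : (-((β : ℂ) * ((U : ℂ) - 2 * μ))).im = 2 * (β * μ.im) := by
    simp only [Complex.neg_im, Complex.mul_im, Complex.ofReal_re, Complex.ofReal_im, Complex.sub_re, Complex.sub_im,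
      Complex.re_ofNat, Complex.im_ofNat, zero_mul, add_zero, zero_sub]
    ring
  have h2 : (Complex.exp (-((β : ℂ) * ((U : ℂ) - 2 * μ)))).re = d * Real.cos (2 * (β * μ.im)) := by
    rw [Complex.exp_re, hw_re, hw_im]
  -- real part of `z₀`
  have hre : (atomicPartitionFn (β : ℂ) (U : ℂ) μ).re = 1 + 2 * (a * Real.cos (β * μ.im)) + d * Real.cos (2 * (β * μ.im)) := by
    rw [atomicPartitionFn]
    simp only [Complex.add_re, Complex.one_re, Complex.mul_re, Complex.re_ofNat, Complex.im_ofNat, zero_mul, sub_zero, h1, h2]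
  -- the numerator of the site ratio
  have hnum : atomicPartitionFnReal 1 ((β : ℂ) * (U : ℂ)).re ((β : ℂ) * μ).re = 1 + 2 * a + d := by
    have e1 : ((β : ℂ) * (U : ℂ)).re = β * U := by rw [← Complex.ofReal_mul, Complex.ofReal_re]
    rw [atomicPartitionFnReal, e1, hv_re, one_mul, one_mul]
  have hre_ge : (1 + 2 * a + d) / 2 ≤ (atomicPartitionFn (β : ℂ) (U : ℂ) μ).re := by
    rw [hre]; nlinarith
  have hnorm_ge : (1 + 2 * a + d) / 2 ≤ ‖atomicPartitionFn (β : ℂ) (U : ℂ) μ‖ := hre_ge.trans (Complex.re_le_norm _)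
  have hpos : 0 < (1 + 2 * a + d) / 2 := by positivity
  have hz : atomicPartitionFn (β : ℂ) (U : ℂ) μ ≠ 0 := fun h => by
    rw [h, norm_zero] at hnorm_ge; linarith
  refine ⟨hz, ?_⟩
  rw [siteRatio, hnum, div_le_iff₀ (norm_pos_iff.2 hz)]
  linarith

/-- The strip of chemical potentials `{μ ∈ ℂ : |β Im μ| < π/6}`. [folklore] -/
def stripMu (β : ℝ) : Set ℂ := {μ | |β * μ.im| < Real.pi / 6}

/-- The strip is open. [folklore] -/
theorem isOpen_stripMu (β : ℝ) : IsOpen (stripMu β) :=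
  isOpen_lt (continuous_abs.comp (continuous_const.mul Complex.continuous_im)) continuous_const

/-- Real chemical potentials lie in the strip. [folklore] -/
theorem ofReal_mem_stripMu (β μ : ℝ) : (μ : ℂ) ∈ stripMu β := by
  show |β * (μ : ℂ).im| < Real.pi / 6
  rw [Complex.ofReal_im, mul_zero, abs_zero]
  positivity

/-- Points of the strip are admissible. [folklore] -/
theorem admissible_of_mem_stripMu {β : ℝ} (U : ℝ) {μ : ℂ} (hμ : μ ∈ stripMu β) :
    atomicPartitionFn (β : ℂ) (U : ℂ) μ ≠ 0 ∧ siteRatio (β : ℂ) (U : ℂ) μ ≤ 2 :=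
  admissible_of_abs_mul_im_mu_le U (le_of_lt hμ)

/-! ### Holomorphy in the chemical potential -/

section StripMu

variable {β : ℝ}

/-- The thermodynamic limit of the two-point function as a function of the complex chemical
potential, at fixed real `β, U`. [cite: Ueltschi1999, Thm. 2.1 (i)–(ii)] -/
def htTwoPointLimitCmu (β U : ℝ) (σ : Fin 2) (y : Site 2) (μ : ℂ) : ℂ :=
  limUnder atTop fun L : ℕ => twoPtTorusC β (U : ℂ) μ L y σ

/-- On the strip the finite-volume functions converge to `htTwoPointLimitCmu`. [cite: Ueltschi1999, Thm. 2.1 (ii)] -/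
theorem tendsto_htTwoPointLimitCmu (hβ0 : 0 ≤ β) (hβ : β ≤ betaHTc) (U : ℝ) (σ : Fin 2) (y : Site 2) {μ : ℂ} (hμ : μ ∈ stripMu β) :
    Tendsto (fun L : ℕ => twoPtTorusC β (U : ℂ) μ L y σ) atTop (𝓝 (htTwoPointLimitCmu β U σ y μ)) := by
  obtain ⟨hz, hr⟩ := admissible_of_mem_stripMu U hμ
  exact tendsto_nhds_limUnder (cauchySeq_tendsto_of_complete (cauchySeq_twoPtTorusC hz hr hβ0 hβ y σ))

/-- **Uniform convergence on the strip.** [cite: Ueltschi1999, proof of Thm. 2.1 (ii) ("uniformly")] -/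
theorem tendstoUniformlyOn_twoPtTorusC_mu (hβ0 : 0 ≤ β) (hβ : β ≤ betaHTc) (U : ℝ) (σ : Fin 2) (y : Site 2) :
    TendstoUniformlyOn (fun (L : ℕ) (μ : ℂ) => twoPtTorusC β (U : ℂ) μ L y σ) (htTwoPointLimitCmu β U σ y) atTop (stripMu β) := by
  refine UniformCauchySeqOn.tendstoUniformlyOn_of_tendsto ?_ fun μ hμ => tendsto_htTwoPointLimitCmu hβ0 hβ U σ y hμ
  refine Metric.uniformCauchySeqOn_iff.2 fun η hη => ?_
  obtain ⟨R, hR⟩ := (tendsto_cauchyBound.eventually (gt_mem_nhds hη)).exists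
  refine ⟨2 * Mbox R y + 2, fun m hm n hn μ hμ => ?_⟩
  obtain ⟨hz, hr⟩ := admissible_of_mem_stripMu U hμ
  rw [dist_eq_norm]
  exact (norm_twoPtTorusC_sub_le hz hr hβ0 hβ y σ R hm hn).trans_lt hR

variable {Λ : Type*} [LinearOrder Λ] [Fintype Λ] {G : SimpleGraph Λ} [DecidableRel G.Adj]

/-- **Holomorphy of the finite-volume two-point function in the chemical potential** on the strip
(degrees `≤ 4`, `0 ≤ β ≤ β₁`, real `U`). [cite: Ueltschi1999, Thm. 2.1 (i)] -/
theorem differentiableOn_twoPtC_mu (hdeg : ∀ v : Λ, (Finset.univ.filter (G.Adj v)).card ≤ 4) (hβ0 : 0 ≤ β) (hβ : β ≤ betaHTc)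
    (U : ℝ) (b₀ : Bond Λ) :
    DifferentiableOn ℂ (fun μ : ℂ => twoPtC G β (U : ℂ) μ b₀) (stripMu β) := by
  -- `X(μ) = A₁ + μ • Y₁`
  set Y₁ : Matrix (Finset (Orb Λ)) (Finset (Orb Λ)) ℂ := (β : ℂ) • nSum (Finset.univ : Finset Λ) with hY₁
  set A₁ : Matrix (Finset (Orb Λ)) (Finset (Orb Λ)) ℂ :=
    -(((β : ℂ) * (U : ℂ)) • nnSum (Finset.univ : Finset Λ)) + hopSum (hubbardCoupling G (β : ℂ)) with hA₁
  have hX : ∀ μ : ℂ, -((β : ℂ) • onSiteSum (U : ℂ) μ (Finset.univ : Finset Λ)) + hopSum (hubbardCoupling G (β : ℂ)) = A₁ + μ • Y₁ := by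
    intro μ
    rw [onSiteSum_eq_smul_sub_smul, hA₁, hY₁, smul_sub, smul_smul, smul_smul, smul_smul, mul_comm μ (β : ℂ), neg_sub, sub_eq_add_neg]
    abel
  have hnum : Differentiable ℂ fun μ : ℂ => (NormedSpace.exp (A₁ + μ • Y₁) * bondOp b₀).trace := by
    intro μ
    set Lm : Matrix (Finset (Orb Λ)) (Finset (Orb Λ)) ℂ →L[ℂ] ℂ :=
      LinearMap.toContinuousLinearMap ((Matrix.traceLinearMap _ ℂ ℂ) ∘ₗ (LinearMap.mulRight ℂ (bondOp b₀))) with hLm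
    exact (Lm.hasFDerivAt.comp_hasDerivAt μ (Matrix.hasDerivAt_exp_add_smul_complex A₁ Y₁ μ)).differentiableAt
  have hden : Differentiable ℂ fun μ : ℂ => (NormedSpace.exp (A₁ + μ • Y₁)).trace :=
    fun μ => (Matrix.hasDerivAt_trace_exp_add_smul_complex A₁ Y₁ μ).differentiableAt
  have hne : ∀ μ ∈ stripMu β, (NormedSpace.exp (A₁ + μ • Y₁)).trace ≠ 0 := by
    intro μ hμ
    obtain ⟨hz, hr⟩ := admissible_of_mem_stripMu U hμ
    have h := Zc_srcCoupling_zero_ne_zero (G := G) (b₀ := b₀) hdeg hz hr hβ0 hβ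
    rwa [Zc, srcCoupling, zero_smul, add_zero, hX μ] at h
  have heq : ∀ μ : ℂ, twoPtC G β (U : ℂ) μ b₀ = (NormedSpace.exp (A₁ + μ • Y₁) * bondOp b₀).trace / (NormedSpace.exp (A₁ + μ • Y₁)).trace := by
    intro μ
    rw [twoPtC_eq_trace_div, hX μ]
  simp_rw [heq]
  exact (hnum.differentiableOn).div hden.differentiableOn hne

/-- The torus functions are holomorphic in `μ` on the strip. [cite: Ueltschi1999, Thm. 2.1 (i)] -/
theorem differentiableOn_twoPtTorusC_mu (hβ0 : 0 ≤ β) (hβ : β ≤ betaHTc) (U : ℝ) (L : ℕ) (y : Site 2) (σ : Fin 2) :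
    DifferentiableOn ℂ (fun μ : ℂ => twoPtTorusC β (U : ℂ) μ L y σ) (stripMu β) := by
  by_cases hL : L = 0
  · subst hL
    have h : (fun μ : ℂ => twoPtTorusC β (U : ℂ) μ 0 y σ) = fun _ => 0 := by
      funext μ; unfold twoPtTorusC; simp
    rw [h]
    exact differentiableOn_const _
  · haveI : NeZero L := ⟨hL⟩
    simp_rw [twoPtTorusC_of_neZero]
    exact differentiableOn_twoPtC_mu (degree_torus_le L) hβ0 hβ U _

/-- **Holomorphy of the infinite-volume two-point function in the chemical potential at high
temperature**: for real `0 ≤ β ≤ β₁` and real `U`, `μ ↦ S_{β,U,μ,σ}(y)` is complex-differentiable on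
the strip `|β Im μ| < π/6`. [cite: Ueltschi1999, Thm. 2.1 (i)–(ii)] -/
theorem differentiableOn_htTwoPointLimitCmu (hβ0 : 0 ≤ β) (hβ : β ≤ betaHTc) (U : ℝ) (σ : Fin 2) (y : Site 2) :
    DifferentiableOn ℂ (htTwoPointLimitCmu β U σ y) (stripMu β) :=
  (tendstoUniformlyOn_twoPtTorusC_mu hβ0 hβ U σ y).tendstoLocallyUniformlyOn.differentiableOn
    (Filter.Eventually.of_forall fun L => differentiableOn_twoPtTorusC_mu hβ0 hβ U L y σ) (isOpen_stripMu β)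

/-- Hence it is analytic on the strip. [cite: Ueltschi1999, Thm. 2.1 (i)] -/
theorem analyticOnNhd_htTwoPointLimitCmu (hβ0 : 0 ≤ β) (hβ : β ≤ betaHTc) (U : ℝ) (σ : Fin 2) (y : Site 2) :
    AnalyticOnNhd ℂ (htTwoPointLimitCmu β U σ y) (stripMu β) :=
  (differentiableOn_htTwoPointLimitCmu hβ0 hβ U σ y).analyticOnNhd (isOpen_stripMu β)

/-- **It extends the real high-temperature two-point function**: at real `μ`,
`htTwoPointLimitCmu β U σ y μ = htTwoPointLimit β U μ σ y`. [cite: Ueltschi1999, Thm. 2.1 (ii)] -/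
theorem htTwoPointLimitCmu_ofReal (hβ0 : 0 ≤ β) (hβ : β ≤ betaHTc) (U : ℝ) (σ : Fin 2) (y : Site 2) (μ : ℝ) :
    htTwoPointLimitCmu β U σ y (μ : ℂ) = htTwoPointLimit β U μ σ y := by
  have h1 := tendsto_htTwoPointLimitCmu hβ0 hβ U σ y (ofReal_mem_stripMu β μ)
  have h2 := tendsto_htTwoPointLimit hβ0 (hβ.trans betaHTc_le_betaHT) U μ σ y
  simp_rw [twoPtTorusC_ofReal] at h1
  exact tendsto_nhds_unique h1 h2

/-! ### The density is real-analytic in the chemical potential at high temperature -/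

/-- The **density per spin at high temperature** as a function of the complex chemical potential:
`n_σ(β, U, μ) = S_{β,U,μ,σ}(0) = lim_L ⟨n_{0̄σ}⟩_{β,L}`. [cite: Ueltschi1999, Thm. 2.1 (ii)] -/
def htDensityC (β U : ℝ) (σ : Fin 2) : ℂ → ℂ := htTwoPointLimitCmu β U σ 0

/-- At real `μ` it is the limit of the finite-volume densities `⟨c†_{0̄σ} c_{0̄σ}⟩_{β,L} = ⟨n_{0̄σ}⟩_{β,L}`.
[cite: Ueltschi1999, Thm. 2.1 (ii)] -/
theorem tendsto_htDensityC_ofReal (hβ0 : 0 ≤ β) (hβ : β ≤ betaHTc) (U μ : ℝ) (σ : Fin 2) :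
    Tendsto (fun L : ℕ => hubbardThermalTwoPoint β U μ L 0 0 σ σ) atTop (𝓝 (htDensityC β U σ (μ : ℂ))) := by
  unfold htDensityC
  rw [htTwoPointLimitCmu_ofReal hβ0 hβ U σ 0 μ]
  exact tendsto_htTwoPointLimit hβ0 (hβ.trans betaHTc_le_betaHT) U μ σ 0

/-- **No incompressible plateau at high temperature**: for `0 ≤ β ≤ β₁` and every real `U` the
density is an ANALYTIC function of the chemical potential on the strip `|β Im μ| < π/6` (which
contains the real axis). [cite: Ueltschi1999, Thm. 2.1 (i)] -/
theorem analyticOnNhd_htDensityC (hβ0 : 0 ≤ β) (hβ : β ≤ betaHTc) (U : ℝ) (σ : Fin 2) :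
    AnalyticOnNhd ℂ (htDensityC β U σ) (stripMu β) :=
  analyticOnNhd_htTwoPointLimitCmu hβ0 hβ U σ 0

end StripMu

end SourceGasC

end Literature.MathematicalPhysics.QuantumLattice

end
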